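import Summits.BirchSwinnertonDyer.BirchSwinnertonDyer.Theorems.InertBadSignedBranchesCccOneLawOnTypeIstarZeroTwistScalarDictionary
import HarnessLib

/-!
# The FRAME UNIT `U ∈ Λˣ` of the 2c-T1 re-typing docket (T3): a coherent tail of wild offsets
# `(o_n^{pⁿ−1})_{n ≥ n₁}` in `lim (ℤ/p^{n+1})ˣ = ℤ_pˣ` is read, at every level `n ≥ n₁` and every `ψ` mod `p^{n+1}`,
# by ONE Iwasawa unit: `U(ψ(γ̃) − 1) = θ_ψ(o_n)`, `θ_ψ = ψ′^{pⁿ−1}` (THEOREMS ONLY; kernel glue «F1″-unit», file 2 of 3)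

Cell `bsd-cm`, seat `bsd-cm-k-ty1` g40 (literature-prover identity), (T3) of director-bsd (993)(a)(iii); pen D1216,
critic NOTE #70/#73, host E-g43-9 / eis S l.8299–8302. Lane `Rank1Residual/Additive/` (precedent p832718, p835994).
THEOREMS ONLY: no `def`, no named fact, no instance, no notation, no `sorry`. Count-neutral.

## What is proved

* `exists_padicInt_toZModPow_eq`: a tail `(w_n ∈ (ℤ/p^{n+1})ˣ)_{n ≥ n₁}` compatible under reduction is the reduction
  of ONE `ω ∈ ℤ_p` (Mathlib `PadicInt.ofIntSeq`), and `ω` is a unit.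
* `exists_frameUnit`: for the cyclotomic `κ` with top generator `γ` matching the variable and `p` odd, and offsets
  `o_n ∈ (ℤ/m(n+1))ˣ` whose wild parts are coherent beyond `n₁` — `π(o_{n+1})^{p^{n+1}−1} = o_n^{pⁿ−1}`, the output of
  `Kato2004.FrameOffsetDescent.unitsMap_pow_eq_pow_of_tame` — there is `U ∈ Λˣ` (namely `Ψ_κ(σ_ω)`,
  `χ_p(σ_ω) = ω`, `GaloisRep.cyclotomicCharacter_rat_surjective`) with
  `HasSum (k ↦ ι(U_k)(ψ(γ̃)−1)^k) (θ_ψ(o_n))` for all `n ≥ n₁` and all `ψ` mod `p^{n+1}`, `θ_ψ = (changeLevel ψ)^{pⁿ−1}` the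
  `W`-currency character of [A′]'s law (ibsb-9 `tsum_eval_psi` p836361 + the DICTIONARY
  `apply_cyclotomicGenerator_pow_mul_apply_cyc_eq_one` + `o_n^{(pⁿ−1)pⁿ} = 1`).
* `tsum_onePlusXPow_sub_one_mul_eq_zero`, `onePlusXPow_sub_one_ne_zero`: the annihilator `Φ = (1+T)^{p^N} − 1` of the
  levels `≤ N` (Washington §7.2) is non-zero and kills every value at `ψ(γ̃) − 1`, `ψ` mod `p^{n+1}`, `n ≤ N`.

HONEST LABELS: count-neutral kernel glue; nothing about BSD is asserted; 2c-T1 NOT closed by this file; 19223 OPEN; BSD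
is proved for no curve. References: [Washington1997] §7.1–7.2, §13.1–13.2; [Kato2004Asterisque] §13.9 (p. 229);
[Kobayashi2003] §8.4 (p. 16); [SerreAbelianLadic1968] Ch. I §1.2.
-/

noncomputable section

open scoped Classical

open Literature.NumberTheory.EllipticCurves Literature.NumberTheory.EllipticCurves.Kato2004
open Literature.NumberTheory.EllipticCurves.Kato2004.EulerSystemValues
open Literature.NumberTheory.GaloisRepresentations
open Summit.BirchSwinnertonDyer.BirchSwinnertonDyer.Theorems

namespace Summit.BirchSwinnertonDyer.Rank1Residual.Additive.CccOneFrameUnit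

variable {p : ℕ} [hp' : Fact p.Prime]

/-! ## §1 A coherent tail of units of `ℤ/p^{n+1}` is ONE unit of `ℤ_p` -/

omit hp' in
/-- Iterating the one-step compatibility down a tail. [folklore] -/
theorem cast_eq_of_compatible (w : ∀ n : ℕ, (ZMod (p ^ (n + 1)))ˣ) (n₁ : ℕ)
    (hw : ∀ n, n₁ ≤ n → ZMod.unitsMap (pow_dvd_pow p (Nat.le_succ (n + 1))) (w (n + 1)) = w n)
    (j m : ℕ) (hm : n₁ ≤ m) (hmj : m ≤ j) :
    ZMod.castHom (pow_dvd_pow p (Nat.succ_le_succ hmj)) (ZMod (p ^ (m + 1))) (w j : ZMod (p ^ (j + 1))) =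
      (w m : ZMod (p ^ (m + 1))) := by
  induction j with
  | zero =>
    obtain rfl : m = 0 := Nat.le_zero.mp hmj
    rw [ZMod.castHom_apply, ZMod.cast_id]
  | succ j ih =>
    rcases hmj.eq_or_lt with rfl | hlt
    · rw [ZMod.castHom_apply, ZMod.cast_id]
    · have hmj' : m ≤ j := Nat.lt_succ_iff.mp hlt
      have hstep : (w j : ZMod (p ^ (j + 1))) =
          ZMod.castHom (pow_dvd_pow p (Nat.le_succ (j + 1))) (ZMod (p ^ (j + 1))) (w (j + 1) : ZMod (p ^ (j + 2))) := by
        rw [← hw j (le_trans hm hmj'), ZMod.unitsMap_val, ZMod.castHom_apply]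
      rw [← ih hmj', hstep, ← RingHom.comp_apply, ZMod.castHom_comp]

/-- **A compatible tail of units is the reduction of one `p`-adic unit** (`ℤ_p = lim ℤ/pⁿ`; Mathlib `PadicInt.ofIntSeq`).
[folklore] -/
theorem exists_padicInt_toZModPow_eq (w : ∀ n : ℕ, (ZMod (p ^ (n + 1)))ˣ) (n₁ : ℕ)
    (hw : ∀ n, n₁ ≤ n → ZMod.unitsMap (pow_dvd_pow p (Nat.le_succ (n + 1))) (w (n + 1)) = w n) :
    ∃ ω : ℤ_[p]ˣ, ∀ n, n₁ ≤ n → PadicInt.toZModPow (n + 1) (ω : ℤ_[p]) = (w n : ZMod (p ^ (n + 1))) := by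
  have hP : p.Prime := hp'.out
  -- the all-level compatible family `a i ∈ ℤ/p^i`
  set a : ∀ i : ℕ, ZMod (p ^ i) := fun i =>
    ZMod.castHom (pow_dvd_pow p (show i ≤ n₁ + i + 1 by omega)) (ZMod (p ^ i))
      (w (n₁ + i) : ZMod (p ^ (n₁ + i + 1))) with ha
  have hcomp : ∀ i, ZMod.castHom (pow_dvd_pow p (Nat.le_succ i)) (ZMod (p ^ i)) (a (i + 1)) = a i := by
    intro i
    simp only [ha]
    rw [← RingHom.comp_apply, ZMod.castHom_comp,
      ← cast_eq_of_compatible w n₁ hw (n₁ + i + 1) (n₁ + i) (by omega) (by omega), ← RingHom.comp_apply,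
      ZMod.castHom_comp]
    rfl
  set f : ℕ → ℤ := fun i => ((a i).val : ℤ) with hf
  have hi : ∀ i, (p : ℤ) ^ i ∣ f (i + 1) - f i := by
    intro i
    have h1 : (((a (i + 1)).val : ℤ) : ZMod (p ^ i)) = (((a i).val : ℤ) : ZMod (p ^ i)) := by
      rw [Int.cast_natCast, Int.cast_natCast, ZMod.natCast_zmod_val, ← ZMod.cast_eq_val,
        ← ZMod.castHom_apply (h := pow_dvd_pow p (Nat.le_succ i)) (R := ZMod (p ^ i)), hcomp i]
    have h2 := (ZMod.intCast_eq_intCast_iff_dvd_sub _ _ _).mp h1.symm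
    simpa [hf] using h2
  set ω : ℤ_[p] := PadicInt.ofIntSeq f (PadicInt.isCauSeq_padicNorm_of_pow_dvd_sub f p hi) with hωdef
  have hω : ∀ i, PadicInt.toZModPow i ω = a i := by
    intro i
    rw [hωdef, PadicInt.toZModPow_ofIntSeq_of_pow_dvd_sub f p hi i, hf]
    simp only [Int.cast_natCast, ZMod.natCast_zmod_val]
  have hωw : ∀ n, n₁ ≤ n → PadicInt.toZModPow (n + 1) ω = (w n : ZMod (p ^ (n + 1))) := by
    intro n hn
    rw [hω (n + 1)]
    simp only [ha]
    exact cast_eq_of_compatible w n₁ hw (n₁ + n + 1) n hn (by omega)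
  -- `ω` is a unit: its reduction mod `p^{n₁+1}` is
  have hunit : IsUnit ω := by
    by_contra hnu
    have hlt : ‖ω‖ < 1 := lt_of_le_of_ne (PadicInt.norm_le_one ω) fun h1 => hnu (PadicInt.isUnit_iff.mpr h1)
    obtain ⟨y, hy⟩ := (PadicInt.norm_lt_one_iff_dvd ω).mp hlt
    have hred : (w n₁ : ZMod (p ^ (n₁ + 1))) = (p : ZMod (p ^ (n₁ + 1))) * PadicInt.toZModPow (n₁ + 1) y := by
      rw [← hωw n₁ le_rfl, hy, map_mul, map_natCast]
    have hpu : IsUnit ((p : ℕ) : ZMod (p ^ (n₁ + 1))) :=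
      isUnit_of_mul_isUnit_left (hred ▸ Units.isUnit (w n₁))
    have hcop := (ZMod.isUnit_iff_coprime p (p ^ (n₁ + 1))).mp hpu
    exact hP.one_lt.ne' (hcop.eq_one_of_dvd (dvd_pow_self p (Nat.succ_ne_zero _)))
  exact ⟨hunit.unit, fun n hn => by rw [IsUnit.unit_spec]; exact hωw n hn⟩

/-! ## §2 The frame unit -/

set_option maxHeartbeats 800000 in
/-- **THE FRAME UNIT.** Let `κ` be cyclotomic with top generator `γ` matching the cyclotomic variable, `p` odd, and let
`o_n ∈ (ℤ/m(n+1))ˣ` (`m(n+1) = cycLevel p (n+1) ∅ = p^{n+1}`) be offsets whose wild parts are coherent beyond `n₁`: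
`π(o_{n+1})^{p^{n+1}−1} = o_n^{pⁿ−1}` (the corollary `Kato2004.FrameOffsetDescent.unitsMap_pow_eq_pow_of_tame` of the
frame-offset descent).  Then ONE unit `U ∈ Λˣ` — `U = Ψ_κ(σ)` for a `σ ∈ Γ_ℚ` with `χ_p(σ) = ω`, `ω ∈ ℤ_pˣ` the limit of the tail —
reads, at EVERY level `n ≥ n₁` and every Dirichlet character `ψ` mod `p^{n+1}` with values in `ℂ_p`, the value
`θ_ψ(o_n)` of the `W`-currency character `θ_ψ = ψ′^{pⁿ−1}` (`ψ′ = changeLevel ψ` to modulus `m(n+1)`) of [A′]'s law at the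
offset: `Σ_k ι(U_k)(ψ(γ̃) − 1)^k = θ_ψ(o_n)`.  (Value of `Ψ(σ)` at `ζ − 1`: ibsb-9 `tsum_eval_psi`; `ζ^{κσ} = θ⁻¹(χ_cyc σ)`: the
DICTIONARY; `θ(w_n) = θ(o_n)⁻¹` because `o_n^{(pⁿ−1)pⁿ} = 1`.)
[cite: Washington1997, §13.1–13.2 and §7.2] [cite: Kato2004Asterisque, §13.9 (p. 229)] [cite: Kobayashi2003, §8.4 (p. 16)] -/
theorem exists_frameUnit {κ : ZpExtension ℚ p} (hκ : κ.IsCyclotomic) {γ : Field.absoluteGaloisGroup ℚ}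
    (hγ : κ.IsTopGenerator γ) (hγc : IsCyclotomicVariable p γ) (hp : p ≠ 2)
    (o : ∀ n : ℕ, (ZMod (cycLevel p (n + 1) ∅))ˣ) (n₁ : ℕ)
    (hcoh : ∀ n, n₁ ≤ n →
      ZMod.unitsMap (show cycLevel p (n + 1) ∅ ∣ cycLevel p (n + 2) ∅ from
          mul_dvd_mul_right (pow_dvd_pow p (Nat.le_succ (n + 1))) _) (o (n + 1)) ^ (p ^ (n + 1) - 1) =
        o n ^ (p ^ n - 1)) :
    ∃ U : (IwasawaAlgebra p)ˣ, ∀ n : ℕ, n₁ ≤ n → ∀ ψ : DirichletCharacter ℂ_[p] (p ^ (n + 1)),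
      HasSum
        (fun k : ℕ ↦ ((algebraMap ℚ_[p] ℂ_[p]).comp (algebraMap ℤ_[p] ℚ_[p]))
            (PowerSeries.coeff k ((U : (IwasawaAlgebra p)ˣ) : IwasawaAlgebra p)) *
          (ψ (cyclotomicGenerator p : ZMod (p ^ (n + 1))) - 1) ^ k)
        (((DirichletCharacter.changeLevel
            (show p ^ (n + 1) ∣ cycLevel p (n + 1) ∅ from dvd_mul_right _ _) ψ) ^ (p ^ n - 1))
          ((o n : (ZMod (cycLevel p (n + 1) ∅))ˣ) : ZMod (cycLevel p (n + 1) ∅))) := by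
  have hP : p.Prime := hp'.out
  set ιZ : ℤ_[p] →+* ℂ_[p] := (algebraMap ℚ_[p] ℂ_[p]).comp (algebraMap ℤ_[p] ℚ_[p]) with hιZ
  -- the tail `w_n = π(o_n^{pⁿ−1}) ∈ (ℤ/p^{n+1})ˣ`
  set w : ∀ n : ℕ, (ZMod (p ^ (n + 1)))ˣ := fun n =>
    ZMod.unitsMap (show p ^ (n + 1) ∣ cycLevel p (n + 1) ∅ from dvd_mul_right _ _) (o n ^ (p ^ n - 1)) with hwdef
  have hw : ∀ n, n₁ ≤ n → ZMod.unitsMap (pow_dvd_pow p (Nat.le_succ (n + 1))) (w (n + 1)) = w n := by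
    intro n hn
    have e1 : ZMod.unitsMap (pow_dvd_pow p (Nat.le_succ (n + 1))) (w (n + 1)) =
        ZMod.unitsMap ((pow_dvd_pow p (Nat.le_succ (n + 1))).trans
          (show p ^ (n + 2) ∣ cycLevel p (n + 2) ∅ from dvd_mul_right _ _)) (o (n + 1) ^ (p ^ (n + 1) - 1)) := by
      simp only [hwdef]
      rw [← MonoidHom.comp_apply, ZMod.unitsMap_comp]
    have e2 : w n = ZMod.unitsMap ((show p ^ (n + 1) ∣ cycLevel p (n + 1) ∅ from dvd_mul_right _ _).trans
          (show cycLevel p (n + 1) ∅ ∣ cycLevel p (n + 2) ∅ from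
            mul_dvd_mul_right (pow_dvd_pow p (Nat.le_succ (n + 1))) _)) (o (n + 1) ^ (p ^ (n + 1) - 1)) := by
      simp only [hwdef]
      rw [← hcoh n hn, ← map_pow, ← MonoidHom.comp_apply, ZMod.unitsMap_comp]
    rw [e1, e2]
  obtain ⟨ω, hω⟩ := exists_padicInt_toZModPow_eq w n₁ hw
  obtain ⟨σ, hσ⟩ := GaloisRep.cyclotomicCharacter_rat_surjective (p := p) ω
  refine ⟨IwasawaCharacter.Psi p ℤ_[p] κ σ, fun n hn ψ => ?_⟩
  haveI : NeZero (p ^ (n + 1)) := ⟨pow_ne_zero _ hP.ne_zero⟩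
  have hz : ‖ψ (cyclotomicGenerator p : ZMod (p ^ (n + 1))) - 1‖ < 1 :=
    CccOneTwistScalarMultiplierValue.norm_apply_cyclotomicGenerator_sub_one_lt hp n ψ
  have hzn : (1 + (ψ (cyclotomicGenerator p : ZMod (p ^ (n + 1))) - 1)) ^ p ^ n = 1 := by
    rw [add_sub_cancel]
    exact CccOneTwistScalarMultiplierValue.apply_cyclotomicGenerator_pow_prime_pow hp n ψ
  have hm : PadicInt.toZModPow n (κ σ).toAdd = ((PadicInt.toZModPow n (κ σ).toAdd).val : ZMod (p ^ n)) :=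
    (ZMod.natCast_zmod_val _).symm
  -- the value of `Ψ(σ)` and the dictionary
  have hval := CccOneTwistScalarMultiplierValue.tsum_eval_psi ιZ norm_algebraMap_coeff_le_one hz κ σ n hzn hm
  have hdic := CccOneTwistScalarDictionary.apply_cyclotomicGenerator_pow_mul_apply_cyc_eq_one hκ hγ hγc hp n ψ hm
  rw [add_sub_cancel] at hval
  -- `χ_cyc^{(p^{n+1})}(σ) = w_n`
  have hcyc : ((modNCyclotomicCharacter ℚ (p ^ (n + 1)) σ : (ZMod (p ^ (n + 1)))ˣ) : ZMod (p ^ (n + 1))) =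
      (w n : ZMod (p ^ (n + 1))) := by
    rw [CyclotomicZp.modNCyclotomicCharacter_eq_toZModPow, hσ, hω n hn]
  -- the offset at modulus `p^{n+1}` and the target value
  set õ : (ZMod (p ^ (n + 1)))ˣ :=
    ZMod.unitsMap (show p ^ (n + 1) ∣ cycLevel p (n + 1) ∅ from dvd_mul_right _ _) (o n) with hõ
  have hT : ((DirichletCharacter.changeLevel
        (show p ^ (n + 1) ∣ cycLevel p (n + 1) ∅ from dvd_mul_right _ _) ψ) ^ (p ^ n - 1))
        ((o n : (ZMod (cycLevel p (n + 1) ∅))ˣ) : ZMod (cycLevel p (n + 1) ∅)) =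
      (ψ ^ (p ^ n - 1)) (õ : ZMod (p ^ (n + 1))) := by
    rw [← map_pow, DirichletCharacter.changeLevel_eq_cast_of_dvd, hõ, ZMod.unitsMap_val]
  have hwn : (w n : ZMod (p ^ (n + 1))) = ((õ ^ (p ^ n - 1) : (ZMod (p ^ (n + 1)))ˣ) : ZMod (p ^ (n + 1))) := by
    simp only [hwdef, hõ, map_pow]
  set X : ℂ_[p] := (ψ ^ (p ^ n - 1)) (õ : ZMod (p ^ (n + 1))) with hX
  have hXe : X = (ψ (õ : ZMod (p ^ (n + 1)))) ^ (p ^ n - 1) := by rw [hX, MulChar.pow_apply_coe]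
  -- `X^{pⁿ} = 1`
  have hcard : Fintype.card (ZMod (p ^ (n + 1)))ˣ = p ^ n * (p - 1) := by
    rw [ZMod.card_units_eq_totient, Nat.totient_prime_pow hP (Nat.succ_pos n), Nat.succ_sub_one]
  have hõ1 : õ ^ (p ^ n * (p - 1)) = 1 := by rw [← hcard]; exact pow_card_eq_one
  have hX1 : X ^ (p ^ n) = 1 := by
    obtain ⟨q, hq⟩ : (p - 1) ∣ (p ^ n - 1) := Nat.sub_one_dvd_pow_sub_one p n
    rw [hXe, ← pow_mul, ← map_pow, ← Units.val_pow_eq_pow_val, hq,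
      show (p - 1) * q * p ^ n = p ^ n * (p - 1) * q by ring, pow_mul, hõ1, one_pow, Units.val_one, map_one]
  have hX0 : X ≠ 0 := fun h0 => by
    rw [h0, zero_pow (pow_ne_zero _ hP.ne_zero)] at hX1
    exact zero_ne_one hX1
  -- `θ(χ_cyc σ) = θ(w_n) = X^{pⁿ−1} = X⁻¹`
  have hθcyc : (ψ ^ (p ^ n - 1))
      ((modNCyclotomicCharacter ℚ (p ^ (n + 1)) σ : (ZMod (p ^ (n + 1)))ˣ) : ZMod (p ^ (n + 1))) = X⁻¹ := by
    rw [hcyc, hwn, MulChar.pow_apply_coe, Units.val_pow_eq_pow_val, map_pow, ← pow_mul, mul_comm, pow_mul,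
      ← MulChar.pow_apply_coe, ← hX]
    apply eq_inv_of_mul_eq_one_left
    rw [← pow_succ, Nat.sub_add_cancel (Nat.one_le_pow _ _ hP.pos), hX1]
  rw [hθcyc] at hdic
  have hvalX : ψ (cyclotomicGenerator p : ZMod (p ^ (n + 1))) ^ (PadicInt.toZModPow n (κ σ).toAdd).val = X := by
    have h := eq_inv_of_mul_eq_one_left hdic
    rwa [inv_inv] at h
  rw [hT, ← hvalX, ← hval]
  exact (summable_map_coeff_mul_pow ιZ (norm_algebraMap_coeff_le_one _) hz).hasSum

/-! ## §3 The annihilator `Φ = (1+T)^{p^N} − 1` of the levels `≤ N` -/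

/-- **`Φ·q` dies at every `ψ(γ̃) − 1` with `ψ` mod `p^{n+1}`, `n ≤ N`** (`ψ(γ̃)^{pⁿ} = 1`, so `(1+z)^{p^N} = 1`; ibsb-9
`tsum_eval_omega_mul`). [cite: Washington1997, §7.2] -/
theorem tsum_onePlusXPow_sub_one_mul_eq_zero (hp : p ≠ 2) {N n : ℕ} (hn : n ≤ N)
    (ψ : DirichletCharacter ℂ_[p] (p ^ (n + 1))) (q : IwasawaAlgebra p) :
    ∑' k : ℕ, ((algebraMap ℚ_[p] ℂ_[p]).comp (algebraMap ℤ_[p] ℚ_[p]))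
        (PowerSeries.coeff k ((((1 + PowerSeries.X : PowerSeries ℤ_[p]) ^ p ^ N - 1)) * q)) *
      (ψ (cyclotomicGenerator p : ZMod (p ^ (n + 1))) - 1) ^ k = 0 := by
  have hz : ‖ψ (cyclotomicGenerator p : ZMod (p ^ (n + 1))) - 1‖ < 1 :=
    CccOneTwistScalarMultiplierValue.norm_apply_cyclotomicGenerator_sub_one_lt hp n ψ
  have hzn : (1 + (ψ (cyclotomicGenerator p : ZMod (p ^ (n + 1))) - 1)) ^ p ^ N = 1 := by
    obtain ⟨k, rfl⟩ := Nat.exists_eq_add_of_le hn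
    rw [add_sub_cancel, pow_add p n k, pow_mul,
      CccOneTwistScalarMultiplierValue.apply_cyclotomicGenerator_pow_prime_pow hp n ψ, one_pow]
  exact CccOneTwistScalarMultiplierValue.tsum_eval_omega_mul _ norm_algebraMap_coeff_le_one hz N q hzn

/-- **`Φ = (1+T)^{p^N} − 1 ≠ 0` in `Λ`** (its coefficient of `T` is `p^N ≠ 0`). [cite: Washington1997, §7.2] -/
theorem onePlusXPow_sub_one_ne_zero (N : ℕ) :
    ((1 + PowerSeries.X : PowerSeries ℤ_[p]) ^ p ^ N - 1) ≠ 0 := by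
  have hP : p.Prime := hp'.out
  have hω : ((1 + PowerSeries.X : PowerSeries ℤ_[p]) ^ p ^ N - 1) =
      ((((1 + Polynomial.X : Polynomial ℤ_[p]) ^ p ^ N - 1 : Polynomial ℤ_[p])) : PowerSeries ℤ_[p]) := by
    simp only [Polynomial.coe_sub, Polynomial.coe_pow, Polynomial.coe_add, Polynomial.coe_one, Polynomial.coe_X]
  rw [hω, Ne, Polynomial.coe_eq_zero_iff]
  intro h0
  have h1 := congrArg (fun P : Polynomial ℤ_[p] => P.coeff 1) h0
  simp only [Polynomial.coeff_sub, Polynomial.coeff_one_add_X_pow, Nat.choose_one_right, Polynomial.coeff_one,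
    one_ne_zero, if_false, sub_zero, Polynomial.coeff_zero] at h1
  exact pow_ne_zero N (Nat.cast_ne_zero.mpr hP.ne_zero : (p : ℤ_[p]) ≠ 0) (by exact_mod_cast h1)

end Summit.BirchSwinnertonDyer.Rank1Residual.Additive.CccOneFrameUnit

end
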